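import Literature.AlgebraicGeometry.Motives.AbelianVarietyDegree
import HarnessLib

/-!
# A Cartier divisor is ample iff some (every) positive multiple is ample: `(q • D)` ample ⇒ `D` ample

Layer `Literature/AlgebraicGeometry/Motives`, namespace `Literature.AlgebraicGeometry.Motives.CartierDivisor` (cell
`hodgecm-mathlib`, typer B-typ01; generic theorems-only leaf — consumed by the (U)-head glue of the Siegel-moduli
uniformisation as the step «`q • Θ ∼ H` ample ⇒ `Θ` ample», but stated for an arbitrary integral scheme).

In the tree's currency an ample Cartier divisor is the record of Görtz–Wedhorn I, Prop. 13.47 (iv) for `𝓛 = 𝒪_X(D)`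
(`CartierDivisor.IsAmple`, `Motives/CartierDivisor`): `X` qcqs and SOME `d ≥ 1` such that every point lies in an
affine non-vanishing locus `X_s`, `s ∈ Γ(X, 𝒪_X(d • D))`.  Hence the converse of the tree's `IsAmple.smul`
(Görtz–Wedhorn I, Prop. 13.50 (1): `𝓛` ample ⇔ `𝓛^{⊗n}` ample for one/all `n ≥ 1`; Hartshorne II Prop. 7.5:
«`𝓛^m` is ample for some `m > 0` iff `𝓛` is ample») is immediate: a witness `d` for `q • D` is the witness `q·d` for
`D`, because `d • (q • D) = (q d) • D` on the nose (`CartierDivisor.smul_smul`).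

## What is typed (all PROVED; no definition, no named fact, no instance, no `sorry`)
* `IsAmple.of_smul (hq : 0 < q) (h : (q • D).IsAmple) : D.IsAmple` — GW I 13.50 (1), direction «⇐»;
* `isAmple_smul_iff (hq : 0 < q) : (q • D).IsAmple ↔ D.IsAmple` — with the tree's `IsAmple.smul` for «⇒».

## References
* [GortzWedhorn2020] U. Görtz, T. Wedhorn, *Algebraic Geometry I*, 2nd ed. (2020): Def. 13.44 and Prop. 13.47 (iv)
  (ample line bundles), Prop. 13.50 (1) (print p. 394; the held e-text shows it on its p. 496).
* [Hartshorne1977] R. Hartshorne, *Algebraic Geometry* (1977): II, Prop. 7.5 (pp. 153–154).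
-/

noncomputable section

open AlgebraicGeometry

universe u

namespace Literature.AlgebraicGeometry.Motives.CartierDivisor

variable {X : Scheme.{u}} [IsIntegral X] {D : CartierDivisor X}

/-- **If a positive multiple `q • D` is ample, then `D` is ample** (Görtz–Wedhorn I, Prop. 13.50 (1), `𝓛^{⊗q}`
ample ⇒ `𝓛` ample): a witness `d ≥ 1` of Prop. 13.47 (iv) for `q • D` — sections of `𝒪(d • (q • D))` with affine
non-vanishing loci through every point — is the witness `q d` for `D`, since `d • (q • D) = (q d) • D`.
[cite: GortzWedhorn2020, Prop. 13.50 (1) (p. 394)] [cite: Hartshorne1977, II Prop. 7.5 (pp. 153–154)] -/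
theorem IsAmple.of_smul {q : ℕ} (hq : 0 < q) (h : (q • D).IsAmple) : D.IsAmple := by
  obtain ⟨hc, hqs, d, hd, H⟩ := h
  refine ⟨hc, hqs, q * d, Nat.mul_pos hq hd, fun x => ?_⟩
  rw [← CartierDivisor.smul_smul]
  exact H x

variable (D) in
/-- **`q • D` is ample iff `D` is ample** (`q ≥ 1`; Görtz–Wedhorn I, Prop. 13.50 (1): `𝓛` ample ⇔ `𝓛^{⊗n}`
ample). [cite: GortzWedhorn2020, Prop. 13.50 (1) (p. 394)] [cite: Hartshorne1977, II Prop. 7.5 (pp. 153–154)] -/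
theorem isAmple_smul_iff {q : ℕ} (hq : 0 < q) : (q • D).IsAmple ↔ D.IsAmple :=
  ⟨IsAmple.of_smul hq, fun h => h.smul hq⟩

end Literature.AlgebraicGeometry.Motives.CartierDivisor

end
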